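import Literature.MathematicalPhysics.QuantumFieldTheory.QuasiLocalGaugePerturbationWilson
import Literature.Probability.LatticeModels.GibbsSpecification
import HarnessLib

/-!
# Quasi-local gauge-invariant perturbations, III: locality of the activities in glued variables

Third file on the tree's `QuasiLocalGaugePerturbation d L G b` (after `QuasiLocalGaugePerturbation`,
`QuasiLocalGaugePerturbationWilson`): what the polymer activities `W_X` and the total `W = ∑_X W_X`
see of a configuration `glueWith Λ u ζ` — the links of a finite set `Λ` carrying the variables `u`,
the other links the exterior `ζ` (tree `glueWith`, `GibbsSpecification.lean`) — as needed for the
DLR kernels of the perturbed torus measures (`QuasiLocalGaugePerturbationKernels.lean`).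
Throughout, `R ⊆ blockCorners b` is a set of block corners containing the corner of every link of
`Λ`, and "`y'` is `M`-near `R`" means `∃ y ∈ R, ∀ i, val (yᵢ - y'ᵢ) ≤ bM ∨ val (y'ᵢ - yᵢ) ≤ bM`
(one way round the torus `ℤ/L` or the other).

## Main results (theorems only: no definition, no named fact)

* `plaquetteSupport_short` — one lattice step moves a block corner coordinate by at most `b` (also
  across the seam `v = L - 1`); hence any two of the (at most three) corners of the support polymer
  of a plaquette (`plaquetteSupport`) are within `b` coordinatewise, one way or the other (the
  one-step estimates of `Summits/…/RobustYangMills/Negative/BetaLipschitz.lean`, inlined).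
* `apply_glueWith_eq_of_forall_not_mem` — an observable of the links of a polymer avoiding the
  blocks of `Λ` does not see `u`; `apply_glueWith_eq_of_short`, `sub_apply_glueWith_eq_of_short` —
  for a SHORT polymer (corners pairwise `M`-near) through a block of `Λ`, two exteriors agreeing on
  the links whose block is `M`-near `R` give the same value; `sum_filter_le_sum_sum_polymersThrough`
  — the union bound over the blocks of `R`; `wilsonAction_glueWith_sub_eq` — the difference of the
  Wilson actions for two such exteriors does not depend on `u` (`b ≥ 1`, `M ≥ 1`).
* `QuasiLocalGaugePerturbation.exists_abs_total_glueWith_sub_le` — if `‖V‖_{b,κ} ≤ δ` (`κ ≥ 0`,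
  tree `NormLE`), `u ↦ V.total (glueWith Λ u ζ)` is within `δ |R|` of a constant (only polymers
  through `R` see `u`; Kotecký–Preiss weighted sums, Friedli–Velenik Thm. 5.4);
  `QuasiLocalGaugePerturbation.exists_abs_total_glueWith_sub_sub_le` — if moreover `W` has RANGE
  CONTROL (a polymer with a non-vanishing activity has coordinate extent `≤ b|X|`) and `ζ, ζ'` agree
  on the links whose block is `(m+1)`-near `R`, then `W(u ζ) - W(u ζ')` is within
  `2 η e^{-κ(m+2)} |R|` of a constant: a polymer through `R` reading a far link has `≥ m + 2`
  blocks (Bałaban's exponential decay of localized terms in the size of the localization domain,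
  CMP 119 (1988) p. 261 (2.42), in the weighted-norm format).

## References

* T. Bałaban, CMP 119 (1988) 243–285, p. 259 (2.25)–(2.28), p. 261 (2.42). [Balaban1988Convergent]
* S. Friedli, Y. Velenik, *Statistical Mechanics of Lattice Systems* (CUP 2017), Thm. 5.4,
  §6.3.2 eq. (6.10) (locality of energy differences). [FriedliVelenik2017]
-/

noncomputable section

open MeasureTheory Finset
open Literature.Probability.LatticeModels (glueWith glueWith_apply_mem glueWith_apply_not_mem)

namespace Literature.MathematicalPhysics.QuantumFieldTheory

section Corners

/-! ### Block corners of neighbouring sites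
(the one-step estimates are those of `Summits/QuantumFields/QCD/Theorems/RobustYangMills/Negative/
BetaLipschitz.lean`, inlined here because Literature cannot import Summits) -/

variable {d L : ℕ} [NeZero L] {b : ℕ}

/-- Any two of the (at most three) corners of `plaquetteSupport b p` differ in every coordinate by
at most `b · M` (`M ≥ 1`, `b ≥ 1`), one way round the torus `ℤ/L` or the other: one lattice step
moves a block corner coordinate by at most `b` (also across the seam `v = L - 1`). [folklore] -/
theorem plaquetteSupport_short (hb : 0 < b) {M : ℕ} (hM : 1 ≤ M) (p : Plaquette d L) (y : Site d L)
    (hy : y ∈ plaquetteSupport b p) (y' : Site d L) (hy' : y' ∈ plaquetteSupport b p) (i : Fin d) :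
    (y i - y' i).val ≤ b * M ∨ (y' i - y i).val ≤ b * M := by
  -- one step: `val (⌊(v+1)/b⌋ b − ⌊v/b⌋ b) ≤ b` in `ℤ/L`
  have hsucc : ∀ v : ZMod L,
      ((((v + 1).val / b * b : ℕ) : ZMod L) - ((v.val / b * b : ℕ) : ZMod L)).val ≤ b := by
    intro v
    have hmL : v.val < L := ZMod.val_lt v
    have hv1 : (v + 1).val = (v.val + 1) % L := by
      have : v + 1 = ((v.val + 1 : ℕ) : ZMod L) := by
        rw [Nat.cast_add, Nat.cast_one, ZMod.natCast_zmod_val]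
      rw [this, ZMod.val_natCast]
    obtain ⟨q, hq_eq, hq1, hq2⟩ : ∃ q : ℕ, v.val / b * b = q ∧ q ≤ v.val ∧ v.val < q + b :=
      ⟨_, rfl, Nat.div_mul_le_self _ _, Nat.lt_div_mul_add hb⟩
    have hmono : v.val / b * b ≤ (v.val + 1) / b * b :=
      Nat.mul_le_mul_right _ (Nat.div_le_div_right (Nat.le_succ _))
    obtain ⟨q', hq'_eq, hq'1, hq'2⟩ :
        ∃ q' : ℕ, (v.val + 1) / b * b = q' ∧ q' ≤ v.val + 1 ∧ q ≤ q' :=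
      ⟨_, rfl, Nat.div_mul_le_self _ _, by rw [← hq_eq]; exact hmono⟩
    rcases Nat.lt_or_ge (v.val + 1) L with h | h
    · rw [hv1, Nat.mod_eq_of_lt h, hq'_eq, hq_eq, ← Nat.cast_sub hq'2, ZMod.val_natCast]
      exact (Nat.mod_le _ _).trans (by omega)
    · have hmL' : v.val + 1 = L := le_antisymm hmL h
      rw [hv1, hmL', Nat.mod_self, Nat.zero_div, zero_mul, Nat.cast_zero, zero_sub, ZMod.neg_val',
        hq_eq, ZMod.val_natCast, Nat.mod_eq_of_lt (by omega : q < L)]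
      exact (Nat.mod_le _ _).trans (by omega)
  -- the corner of `x + eⱼ` vs the corner of `x`, coordinate `i`
  have hshift : ∀ (x : Site d L) (j i : Fin d),
      (blockCorner b (x.shift j) i - blockCorner b x i).val ≤ b := by
    intro x j i
    by_cases hij : i = j
    · subst hij
      have : (x.shift i) i = x i + 1 := by simp [Site.shift]
      simp only [blockCorner, this]
      exact hsucc (x i)
    · have : (x.shift j) i = x i := by simp [Site.shift, hij]
      simp only [blockCorner, this, sub_self, ZMod.val_zero]
      exact Nat.zero_le _
  -- the corners of `x + eⱼ` and `x + eₗ`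
  have hpair : ∀ (x : Site d L) (j l i : Fin d),
      (blockCorner b (x.shift j) i - blockCorner b (x.shift l) i).val ≤ b ∨
        (blockCorner b (x.shift l) i - blockCorner b (x.shift j) i).val ≤ b := by
    intro x j l i
    have hne : ∀ {k : Fin d}, i ≠ k → blockCorner b (x.shift k) i = blockCorner b x i :=
      fun {k} hik => by
        have : (x.shift k) i = x i := by simp [Site.shift, hik]
        simp only [blockCorner, this]
    by_cases hij : i = j
    · by_cases hil : i = l
      · left
        rw [← hij, ← hil, sub_self, ZMod.val_zero]
        exact Nat.zero_le _
      · left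
        rw [hne hil]
        exact hshift x j i
    · right
      rw [hne hij]
      exact hshift x l i
  have hbM : b ≤ b * M := Nat.le_mul_of_pos_right b hM
  suffices h : (y i - y' i).val ≤ b ∨ (y' i - y i).val ≤ b from
    h.imp (fun h => h.trans hbM) (fun h => h.trans hbM)
  have h0 : ∀ z : Site d L, (z i - z i).val ≤ b ∨ (z i - z i).val ≤ b := fun z =>
    Or.inl (by rw [sub_self, ZMod.val_zero]; exact Nat.zero_le _)
  simp only [plaquetteSupport, Finset.mem_insert, Finset.mem_singleton] at hy hy'
  rcases hy with rfl | rfl | rfl <;> rcases hy' with rfl | rfl | rfl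
  · exact h0 (blockCorner b p.1)
  · exact Or.inr (hshift p.1 p.2.1.1 i)
  · exact Or.inr (hshift p.1 p.2.1.2 i)
  · exact Or.inl (hshift p.1 p.2.1.1 i)
  · exact h0 (blockCorner b (p.1.shift p.2.1.1))
  · exact hpair p.1 p.2.1.1 p.2.1.2 i
  · exact Or.inl (hshift p.1 p.2.1.2 i)
  · exact hpair p.1 p.2.1.2 p.2.1.1 i
  · exact h0 (blockCorner b (p.1.shift p.2.1.2))

end Corners

section Polymers

/-! ### What an observable of the links of a polymer sees of the glued variables -/

variable {d L : ℕ} [NeZero L] {G : Type*} {b : ℕ}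

/-- An observable of the links of a polymer avoiding the blocks of `Λ` does not see the glued
variables. [folklore] -/
theorem apply_glueWith_eq_of_forall_not_mem {Λ : Finset (Edge d L)} {X : Finset (Site d L)}
    (hXΛ : ∀ e ∈ Λ, blockCorner b e.1 ∉ X) {F : GaugeConfig d L G → ℝ}
    (hF : DependsOn F (↑(polymerEdges b X) : Set (Edge d L))) (ζ : GaugeConfig d L G)
    (u u₀ : Λ → G) : F (glueWith Λ u ζ) = F (glueWith Λ u₀ ζ) :=
  hF fun e he => by
    have heX : blockCorner b e.1 ∈ X := mem_polymerEdges_iff.1 (Finset.mem_coe.1 he)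
    have heΛ : e ∉ Λ := fun h => hXΛ e h heX
    rw [glueWith_apply_not_mem _ _ _ heΛ, glueWith_apply_not_mem _ _ _ heΛ]

/-- An observable of the links of a SHORT polymer (any two corners within `b·M` coordinatewise, one
way round the torus or the other) through a block of `Λ` reads, off `Λ`, only links whose block is
`M`-near the corners `R ⊇ corners(Λ)`; two exteriors agreeing on those links give it the same value
on the glued configurations. [folklore] -/
theorem apply_glueWith_eq_of_short {R : Finset (Site d L)} {Λ : Finset (Edge d L)}
    (hΛ : ∀ e ∈ Λ, blockCorner b e.1 ∈ R) {M : ℕ} {ζ ζ' : GaugeConfig d L G}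
    (hζ : ∀ e : Edge d L, (∃ y ∈ R, ∀ i, (y i - blockCorner b e.1 i).val ≤ b * M ∨
      (blockCorner b e.1 i - y i).val ≤ b * M) → ζ e = ζ' e)
    {X : Finset (Site d L)} (hXΛ : ∃ e ∈ Λ, blockCorner b e.1 ∈ X)
    (hX : ∀ y ∈ X, ∀ y' ∈ X, ∀ i, (y i - y' i).val ≤ b * M ∨ (y' i - y i).val ≤ b * M)
    {F : GaugeConfig d L G → ℝ} (hF : DependsOn F (↑(polymerEdges b X) : Set (Edge d L)))
    (u : Λ → G) : F (glueWith Λ u ζ) = F (glueWith Λ u ζ') := by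
  obtain ⟨e₀, he₀Λ, he₀X⟩ := hXΛ
  refine hF fun e he => ?_
  have heX : blockCorner b e.1 ∈ X := mem_polymerEdges_iff.1 (Finset.mem_coe.1 he)
  by_cases heΛ : e ∈ Λ
  · rw [glueWith_apply_mem _ _ _ heΛ, glueWith_apply_mem _ _ _ heΛ]
  · rw [glueWith_apply_not_mem _ _ _ heΛ, glueWith_apply_not_mem _ _ _ heΛ]
    exact hζ e ⟨blockCorner b e₀.1, hΛ e₀ he₀Λ, hX _ he₀X _ heX⟩

/-- For a short polymer, the difference of an observable of its links between two exteriors that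
agree near `R` does not depend on the glued variables. [folklore] -/
theorem sub_apply_glueWith_eq_of_short {R : Finset (Site d L)} {Λ : Finset (Edge d L)}
    (hΛ : ∀ e ∈ Λ, blockCorner b e.1 ∈ R) {M : ℕ} {ζ ζ' : GaugeConfig d L G}
    (hζ : ∀ e : Edge d L, (∃ y ∈ R, ∀ i, (y i - blockCorner b e.1 i).val ≤ b * M ∨
      (blockCorner b e.1 i - y i).val ≤ b * M) → ζ e = ζ' e)
    {X : Finset (Site d L)}
    (hX : ∀ y ∈ X, ∀ y' ∈ X, ∀ i, (y i - y' i).val ≤ b * M ∨ (y' i - y i).val ≤ b * M)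
    {F : GaugeConfig d L G → ℝ} (hF : DependsOn F (↑(polymerEdges b X) : Set (Edge d L)))
    (u u₀ : Λ → G) :
    F (glueWith Λ u ζ) - F (glueWith Λ u ζ') = F (glueWith Λ u₀ ζ) - F (glueWith Λ u₀ ζ') := by
  by_cases hXΛ : ∃ e ∈ Λ, blockCorner b e.1 ∈ X
  · rw [apply_glueWith_eq_of_short hΛ hζ hXΛ hX hF u,
      apply_glueWith_eq_of_short hΛ hζ hXΛ hX hF u₀, sub_self, sub_self]
  · push Not at hXΛ
    rw [apply_glueWith_eq_of_forall_not_mem hXΛ hF ζ u u₀,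
      apply_glueWith_eq_of_forall_not_mem hXΛ hF ζ' u u₀]

/-- **Union bound over the blocks of `R`**: a nonnegative function summed over the polymers with a
property `P` forcing them to meet `R` is at most its double sum over `y ∈ R` and the polymers
through `y` with `P`. [folklore] -/
theorem sum_filter_le_sum_sum_polymersThrough (R : Finset (Site d L))
    (P : Finset (Site d L) → Prop) [DecidablePred P]
    (hP : ∀ X ∈ polymers (d := d) (L := L) b, P X → ∃ y ∈ R, y ∈ X)
    {s : Finset (Site d L) → ℝ} (hs : ∀ X, 0 ≤ s X) :
    ∑ X ∈ (polymers b).filter P, s X ≤ ∑ y ∈ R, ∑ X ∈ (polymersThrough b y).filter P, s X := by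
  have hinner : ∀ y, ∑ X ∈ (polymersThrough b y).filter P, s X =
      ∑ X ∈ (polymers b).filter P, if y ∈ X then s X else 0 := fun y => by
    rw [← Finset.sum_filter]
    congr 1
    ext X
    simp only [Finset.mem_filter, mem_polymersThrough_iff]
    tauto
  rw [Finset.sum_congr rfl fun y _ => hinner y, Finset.sum_comm]
  refine Finset.sum_le_sum fun X hX => ?_
  obtain ⟨y, hyR, hyX⟩ := hP X (Finset.mem_filter.1 hX).1 (Finset.mem_filter.1 hX).2
  calc s X = if y ∈ X then s X else 0 := by rw [if_pos hyX]
    _ ≤ ∑ y ∈ R, if y ∈ X then s X else 0 :=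
      Finset.single_le_sum (f := fun y => if y ∈ X then s X else 0)
        (fun y _ => by split_ifs; exacts [hs X, le_rfl]) hyR

variable [Group G]

/-- The difference of the Wilson actions of the configurations glued with two exteriors agreeing
on the links whose block is `M`-near `R` (`M ≥ 1`, `b ≥ 1`) does not depend on the glued
variables: a plaquette with a link in `Λ` has all its links in blocks adjacent to `R`. [folklore] -/
theorem wilsonAction_glueWith_sub_eq {N : ℕ} (ρ : G →* Matrix (Fin N) (Fin N) ℂ) (hb : 0 < b)
    {R : Finset (Site d L)} {Λ : Finset (Edge d L)} (hΛ : ∀ e ∈ Λ, blockCorner b e.1 ∈ R)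
    {M : ℕ} (hM : 1 ≤ M) {ζ ζ' : GaugeConfig d L G}
    (hζ : ∀ e : Edge d L, (∃ y ∈ R, ∀ i, (y i - blockCorner b e.1 i).val ≤ b * M ∨
      (blockCorner b e.1 i - y i).val ≤ b * M) → ζ e = ζ' e)
    (u u₀ : Λ → G) :
    wilsonAction ρ (glueWith Λ u ζ) - wilsonAction ρ (glueWith Λ u ζ') =
      wilsonAction ρ (glueWith Λ u₀ ζ) - wilsonAction ρ (glueWith Λ u₀ ζ') := by
  simp only [wilsonAction_eq_sum_plaquetteCost, ← Finset.sum_sub_distrib]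
  refine Finset.sum_congr rfl fun p _ => ?_
  exact sub_apply_glueWith_eq_of_short hΛ hζ (plaquetteSupport_short hb hM p)
    (F := fun U => plaquetteCost ρ U p)
    (fun U U' hUU' => plaquetteCost_congr ρ fun e he => hUU' e (Finset.mem_coe.2 he)) u u₀

end Polymers

section Oscillation

/-! ### Oscillation of total perturbations in the glued variables -/

namespace QuasiLocalGaugePerturbation

variable {d L : ℕ} [NeZero L] {G : Type*} [Group G] [MeasurableSpace G] {b : ℕ}

/-- **Oscillation of a small total perturbation in the glued variables.** If `‖V‖_{b,κ} ≤ δ` with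
`κ ≥ 0`, then on the configurations glued inside `Λ` (blocks in `R ⊆` corners) with a fixed
exterior, `V.total` is within `δ |R|` of a constant: only the polymers through `R` see the glued
variables, and their sup norms sum to at most `∑_{y ∈ R} ∑_{X ∋ y} ‖V_X‖_∞ ≤ |R| δ`. [folklore] -/
theorem exists_abs_total_glueWith_sub_le (V : QuasiLocalGaugePerturbation d L G b) {κ δ : ℝ}
    (hκ : 0 ≤ κ) (hV : V.NormLE κ δ) {R : Finset (Site d L)} (hR : R ⊆ blockCorners b)
    {Λ : Finset (Edge d L)} (hΛ : ∀ e ∈ Λ, blockCorner b e.1 ∈ R) (ζ : GaugeConfig d L G) :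
    ∃ c : ℝ, ∀ u : Λ → G, |V.total (glueWith Λ u ζ) - c| ≤ δ * R.card := by
  classical
  set bad : Finset (Site d L) → Prop := fun X => ∃ y ∈ R, y ∈ X with hbad
  let u₀ : Λ → G := fun _ => 1
  refine ⟨∑ X ∈ (polymers b).filter (fun X => ¬ bad X), V.act X (glueWith Λ u₀ ζ), fun u => ?_⟩
  have hsplit : V.total (glueWith Λ u ζ) = ∑ X ∈ (polymers b).filter bad, V.act X (glueWith Λ u ζ) +
      ∑ X ∈ (polymers b).filter (fun X => ¬ bad X), V.act X (glueWith Λ u ζ) :=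
    (Finset.sum_filter_add_sum_filter_not _ _ _).symm
  have hgood : ∑ X ∈ (polymers b).filter (fun X => ¬ bad X), V.act X (glueWith Λ u ζ) =
      ∑ X ∈ (polymers b).filter (fun X => ¬ bad X), V.act X (glueWith Λ u₀ ζ) :=
    Finset.sum_congr rfl fun X hX =>
      apply_glueWith_eq_of_forall_not_mem
        (fun e he heX => (Finset.mem_filter.1 hX).2 ⟨_, hΛ e he, heX⟩) (V.dependsOn X) ζ u u₀
  rw [hsplit, hgood, add_sub_cancel_right]
  have hy : ∀ y ∈ R, ∑ X ∈ (polymersThrough b y).filter bad, V.supNorm X ≤ δ := fun y hy =>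
    calc ∑ X ∈ (polymersThrough b y).filter bad, V.supNorm X
        ≤ ∑ X ∈ polymersThrough b y, V.supNorm X :=
          Finset.sum_le_sum_of_subset_of_nonneg (Finset.filter_subset _ _)
            fun X _ _ => V.supNorm_nonneg X
      _ ≤ V.weightedSum κ y := Finset.sum_le_sum fun X _ =>
          le_mul_of_one_le_right (V.supNorm_nonneg X)
            (Real.one_le_exp (mul_nonneg hκ (Nat.cast_nonneg _)))
      _ ≤ δ := hV y (hR hy)
  calc |∑ X ∈ (polymers b).filter bad, V.act X (glueWith Λ u ζ)|
      ≤ ∑ X ∈ (polymers b).filter bad, |V.act X (glueWith Λ u ζ)| := Finset.abs_sum_le_sum_abs _ _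
    _ ≤ ∑ X ∈ (polymers b).filter bad, V.supNorm X :=
        Finset.sum_le_sum fun X _ => V.abs_act_le_supNorm X _
    _ ≤ ∑ y ∈ R, ∑ X ∈ (polymersThrough b y).filter bad, V.supNorm X :=
        sum_filter_le_sum_sum_polymersThrough R bad (fun X _ h => h) V.supNorm_nonneg
    _ ≤ ∑ _y ∈ R, δ := Finset.sum_le_sum hy
    _ = δ * R.card := by rw [Finset.sum_const, nsmul_eq_mul, mul_comm]

/-- **Oscillation of the difference of a small, range-controlled total perturbation between two
exteriors agreeing near `R`.** If `‖W‖_{b,κ} ≤ η` (`κ ≥ 0`), `W` has range control (a polymer with a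
non-vanishing activity has coordinate extent `≤ b|X|`) and the exteriors `ζ, ζ'` agree on every
link whose block is `(m+1)`-near `R`, then `W(u ζ) - W(u ζ')` is within `2 η e^{-κ(m+2)} |R|` of a
constant in the glued variables `u`: a polymer through `R` reading a far link has two corners more
than `b(m+1)` apart, hence at least `m + 2` blocks, and
`∑_{X ∋ y, |X| ≥ m+2} ‖W_X‖_∞ ≤ η e^{-κ(m+2)}`. [folklore] -/
theorem exists_abs_total_glueWith_sub_sub_le (W : QuasiLocalGaugePerturbation d L G b) {κ η : ℝ}
    (hκ : 0 ≤ κ) (hW : W.NormLE κ η)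
    (hRC : ∀ X : Finset (Site d L), X ∈ polymers b → (∃ U : GaugeConfig d L G, W.act X U ≠ 0) →
      ∀ y ∈ X, ∀ y' ∈ X, ∀ i : Fin d, (y i - y' i).val ≤ b * X.card ∨ (y' i - y i).val ≤ b * X.card)
    {R : Finset (Site d L)} (hR : R ⊆ blockCorners b) {Λ : Finset (Edge d L)}
    (hΛ : ∀ e ∈ Λ, blockCorner b e.1 ∈ R) (m : ℕ) {ζ ζ' : GaugeConfig d L G}
    (hζ : ∀ e : Edge d L, (∃ y ∈ R, ∀ i, (y i - blockCorner b e.1 i).val ≤ b * (m + 1) ∨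
      (blockCorner b e.1 i - y i).val ≤ b * (m + 1)) → ζ e = ζ' e) :
    ∃ c : ℝ, ∀ u : Λ → G, |W.total (glueWith Λ u ζ) - W.total (glueWith Λ u ζ') - c| ≤
      2 * (η * Real.exp (-(κ * (m + 2)))) * R.card := by
  classical
  set bad : Finset (Site d L) → Prop := fun X => (∃ y ∈ R, y ∈ X) ∧ m + 2 ≤ X.card with hbad
  let u₀ : Λ → G := fun _ => 1
  set D : Finset (Site d L) → (Λ → G) → ℝ := fun X u =>
    W.act X (glueWith Λ u ζ) - W.act X (glueWith Λ u ζ') with hD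
  refine ⟨∑ X ∈ (polymers b).filter (fun X => ¬ bad X), D X u₀, fun u => ?_⟩
  have htot : W.total (glueWith Λ u ζ) - W.total (glueWith Λ u ζ') = ∑ X ∈ polymers b, D X u := by
    simp only [QuasiLocalGaugePerturbation.total, hD, Finset.sum_sub_distrib]
  have hsplit : ∑ X ∈ polymers b, D X u = ∑ X ∈ (polymers b).filter bad, D X u +
      ∑ X ∈ (polymers b).filter (fun X => ¬ bad X), D X u :=
    (Finset.sum_filter_add_sum_filter_not _ _ _).symm
  have hgood : ∑ X ∈ (polymers b).filter (fun X => ¬ bad X), D X u =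
      ∑ X ∈ (polymers b).filter (fun X => ¬ bad X), D X u₀ := by
    refine Finset.sum_congr rfl fun X hX => ?_
    obtain ⟨hXp, hXb⟩ := Finset.mem_filter.1 hX
    by_cases hXR : ∃ y ∈ R, y ∈ X
    · have hcard : X.card ≤ m + 1 := by
        have : ¬ (m + 2 ≤ X.card) := fun h => hXb ⟨hXR, h⟩
        omega
      by_cases hact : ∃ U, W.act X U ≠ 0
      · have hshort : ∀ y ∈ X, ∀ y' ∈ X, ∀ i, (y i - y' i).val ≤ b * (m + 1) ∨
            (y' i - y i).val ≤ b * (m + 1) := fun y hy y' hy' i =>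
          (hRC X hXp hact y hy y' hy' i).imp (fun h => h.trans (Nat.mul_le_mul_left b hcard))
            (fun h => h.trans (Nat.mul_le_mul_left b hcard))
        exact sub_apply_glueWith_eq_of_short hΛ hζ hshort (W.dependsOn X) u u₀
      · push Not at hact
        simp only [hD, hact, sub_self]
    · push Not at hXR
      have hXΛ : ∀ e ∈ Λ, blockCorner b e.1 ∉ X := fun e he heX => hXR _ (hΛ e he) heX
      simp only [hD]
      rw [apply_glueWith_eq_of_forall_not_mem hXΛ (W.dependsOn X) ζ u u₀,
        apply_glueWith_eq_of_forall_not_mem hXΛ (W.dependsOn X) ζ' u u₀]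
  rw [htot, hsplit, hgood, add_sub_cancel_right]
  have hy : ∀ y ∈ R, ∑ X ∈ (polymersThrough b y).filter bad, 2 * W.supNorm X ≤
      2 * (η * Real.exp (-(κ * (m + 2)))) := fun y hy => by
    rw [← Finset.mul_sum]
    refine mul_le_mul_of_nonneg_left ?_ zero_le_two
    calc ∑ X ∈ (polymersThrough b y).filter bad, W.supNorm X
        ≤ ∑ X ∈ (polymersThrough b y).filter bad,
            W.supNorm X * Real.exp (κ * X.card) * Real.exp (-(κ * (m + 2))) :=
          Finset.sum_le_sum fun X hX => by
            have hc : (m : ℝ) + 2 ≤ X.card := by exact_mod_cast (Finset.mem_filter.1 hX).2.2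
            rw [mul_assoc, ← Real.exp_add]
            exact le_mul_of_one_le_right (W.supNorm_nonneg X)
              (Real.one_le_exp (by nlinarith [mul_le_mul_of_nonneg_left hc hκ]))
      _ = (∑ X ∈ (polymersThrough b y).filter bad, W.supNorm X * Real.exp (κ * X.card)) *
            Real.exp (-(κ * (m + 2))) := by rw [Finset.sum_mul]
      _ ≤ W.weightedSum κ y * Real.exp (-(κ * (m + 2))) :=
          mul_le_mul_of_nonneg_right (Finset.sum_le_sum_of_subset_of_nonneg
            (Finset.filter_subset _ _) fun X _ _ =>
              mul_nonneg (W.supNorm_nonneg X) (Real.exp_pos _).le) (Real.exp_pos _).le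
      _ ≤ η * Real.exp (-(κ * (m + 2))) :=
          mul_le_mul_of_nonneg_right (hW y (hR hy)) (Real.exp_pos _).le
  calc |∑ X ∈ (polymers b).filter bad, D X u|
      ≤ ∑ X ∈ (polymers b).filter bad, |D X u| := Finset.abs_sum_le_sum_abs _ _
    _ ≤ ∑ X ∈ (polymers b).filter bad, 2 * W.supNorm X := Finset.sum_le_sum fun X _ => by
        simp only [hD]
        calc |W.act X (glueWith Λ u ζ) - W.act X (glueWith Λ u ζ')|
            ≤ |W.act X (glueWith Λ u ζ)| + |W.act X (glueWith Λ u ζ')| := abs_sub _ _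
          _ ≤ W.supNorm X + W.supNorm X :=
              add_le_add (W.abs_act_le_supNorm X _) (W.abs_act_le_supNorm X _)
          _ = 2 * W.supNorm X := by ring
    _ ≤ ∑ y ∈ R, ∑ X ∈ (polymersThrough b y).filter bad, 2 * W.supNorm X :=
        sum_filter_le_sum_sum_polymersThrough R bad (fun X _ h => h.1)
          fun X => mul_nonneg zero_le_two (W.supNorm_nonneg X)
    _ ≤ ∑ _y ∈ R, 2 * (η * Real.exp (-(κ * (m + 2)))) := Finset.sum_le_sum hy
    _ = 2 * (η * Real.exp (-(κ * (m + 2)))) * R.card := by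
        rw [Finset.sum_const, nsmul_eq_mul, mul_comm]

end QuasiLocalGaugePerturbation

end Oscillation

end Literature.MathematicalPhysics.QuantumFieldTheory

end
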